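import Mathlib.Combinatorics.Additive.Energy
import Mathlib.Combinatorics.Additive.PluenneckeRuzsa
import Mathlib.Data.ZMod.Basic
import Mathlib.Algebra.GroupWithZero.Action.Pointwise.Finset
import Mathlib.Algebra.Ring.Action.Pointwise.Finset
import Mathlib.Tactic
import HarnessLib

/-!
# The Glibichuk–Konyagin dichotomy for the quotient set `(A − A)/(A − A)` in `𝔽_p`

Topic `Literature/Combinatorics/Additive` (finite-field sum–product theory). Everything here is
PROVED; no definitions, no named facts.

For a finite set `A` of a field, write `R(A) = {(a − b)/(c − d) : a, b, c, d ∈ A, c ≠ d}` for its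
quotient set. The two classical observations of Glibichuk–Konyagin [GlibichukKonyagin2007, §2]
and Garaev [Garaev2007, §2] (locators at section level), which start every elementary sum–product estimate in prime
fields (Bourgain–Katz–Tao, Bourgain–Glibichuk–Konyagin, Garaev, Katz–Shen, …), are:

* if `η ∉ R(A)` then `(x, y) ↦ x + η y` is injective on `A × A`, so `|A + ηA| = |A|²`
  (`card_sq_le_card_add_smul_of_forall_ne`);
* if `R(A) ≠ 𝔽_p` then some `ξ ∈ R(A)` has `ξ + 1 ∉ R(A)` (`exists_mem_quot_add_one_not_mem`),
  because `R(A) ∋ 0` would otherwise be closed under `+1` and exhaust `𝔽_p`;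
* if `R(A) = 𝔽_p` and `|A|² < p`, some `ξ ≠ 0` has at most `|A|²` representations, whence
  `E₊(A, ξA) ≤ 2|A|²` and `|A + ξA| ≥ |A|²/2` (`card_sq_le_two_mul_card_add_smul`).

In either case, writing `ξ = (a₁ − a₂)/(a₃ − a₄)` and dilating by `a₃ − a₄`, one gets the
**dichotomy in sumset form** (`glibichuk_konyagin_six_dilates`): for `A ⊆ 𝔽_p` with `2 ≤ |A|`
and `|A|² < p` there are `a₁, …, a₆ ∈ A` with

  `|A|² ≤ 2 · |a₁A − a₂A + a₃A − a₄A + a₅A − a₆A|`.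

This is the form consumed by Garaev's scheme (`Literature/Combinatorics/Additive/SumProductFp.lean`
in this programme) and by the crux `DlogGraphFlat` of `Summits/QuantumAdvantage` (sector A, stub
`stub_dlogGKDichotomy`, verbatim this statement).

References: A. A. Glibichuk, S. V. Konyagin, *Additive properties of product sets in fields of
prime order*, in: Additive Combinatorics, CRM Proc. Lecture Notes 43 (2007) 279–286;
M. Z. Garaev, *An explicit sum-product estimate in 𝔽_p*, IMRN 2007, rnm035 (arXiv:math/0702780).
-/

namespace Literature.Combinatorics.Additive

open Finset
open scoped Pointwise Combinatorics.Additive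

section GK

variable {F : Type*} [Field F] [DecidableEq F]

/-- If `η` is not a quotient `(a − b)/(c − d)` of elements of `A` (`c ≠ d`), then
`(x, y) ↦ x + η y` is injective on `A × A`, so `|A|² ≤ |A + η A|`.
[cite: GlibichukKonyagin2007, §2 (the quotient-set lemma); also Garaev2007, §2] -/
theorem card_sq_le_card_add_smul_of_forall_ne (A : Finset F) (η : F)
    (hη : ∀ a ∈ A, ∀ b ∈ A, ∀ c ∈ A, ∀ d ∈ A, c ≠ d → η ≠ (a - b) / (c - d)) :
    A.card ^ 2 ≤ (A + η • A).card := by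
  rw [sq, ← Finset.card_product]
  refine Finset.card_le_card_of_injOn (fun xy => xy.1 + η * xy.2) ?_ ?_
  · intro xy hxy
    rw [Finset.mem_coe, Finset.mem_product] at hxy
    rw [Finset.mem_coe]
    exact Finset.add_mem_add hxy.1 (Finset.smul_mem_smul_finset (a := η) hxy.2)
  · intro xy hxy xy' hxy' h
    rw [Finset.mem_coe, Finset.mem_product] at hxy hxy'
    simp only at h
    by_cases hy : xy.2 = xy'.2
    · have hx : xy.1 = xy'.1 := by rw [hy] at h; exact add_right_cancel h
      exact Prod.ext hx hy
    · exfalso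
      refine hη xy'.1 hxy'.1 xy.1 hxy.1 xy.2 hxy.2 xy'.2 hxy'.2 hy ?_
      have hsub : xy.2 - xy'.2 ≠ 0 := sub_ne_zero.mpr hy
      rw [eq_div_iff hsub]
      linear_combination h

/-- Dilating `A + ξA`, `ξ = (a₁ − a₂)/(a₃ − a₄)`, by `a₃ − a₄` lands in the four-fold sum of dilates
`a₃A − a₄A + a₁A − a₂A`. [cite: Garaev2007, §2] -/
theorem smul_add_smul_subset_four (A : Finset F) {a₁ a₂ a₃ a₄ : F} (h34 : a₃ ≠ a₄) :
    (a₃ - a₄) • (A + ((a₁ - a₂) / (a₃ - a₄)) • A) ⊆ a₃ • A - a₄ • A + a₁ • A - a₂ • A := by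
  intro z hz
  rw [Finset.mem_smul_finset] at hz
  obtain ⟨w, hw, rfl⟩ := hz
  rw [Finset.mem_add] at hw
  obtain ⟨x, hx, v, hv, rfl⟩ := hw
  rw [Finset.mem_smul_finset] at hv
  obtain ⟨y, hy, rfl⟩ := hv
  have hsub : a₃ - a₄ ≠ 0 := sub_ne_zero.mpr h34
  have hval : (a₃ - a₄) • (x + ((a₁ - a₂) / (a₃ - a₄)) • y) =
      a₃ * x - a₄ * x + a₁ * y - a₂ * y := by
    simp only [smul_eq_mul]
    field_simp
    ring
  rw [hval]
  exact Finset.sub_mem_sub (Finset.add_mem_add (Finset.sub_mem_sub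
    (Finset.smul_mem_smul_finset (a := a₃) hx) (Finset.smul_mem_smul_finset (a := a₄) hx))
    (Finset.smul_mem_smul_finset (a := a₁) hy)) (Finset.smul_mem_smul_finset (a := a₂) hy)

/-- Dilating `A + (ξ + 1)A`, `ξ = (a₁ − a₂)/(a₃ − a₄)`, by `a₃ − a₄` lands in the six-fold sum of
dilates `a₃A − a₄A + a₁A − a₂A + a₃A − a₄A`. [cite: Garaev2007, §2] -/
theorem smul_add_smul_subset_six (A : Finset F) {a₁ a₂ a₃ a₄ : F} (h34 : a₃ ≠ a₄) :
    (a₃ - a₄) • (A + ((a₁ - a₂) / (a₃ - a₄) + 1) • A) ⊆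
      a₃ • A - a₄ • A + a₁ • A - a₂ • A + a₃ • A - a₄ • A := by
  intro z hz
  rw [Finset.mem_smul_finset] at hz
  obtain ⟨w, hw, rfl⟩ := hz
  rw [Finset.mem_add] at hw
  obtain ⟨x, hx, v, hv, rfl⟩ := hw
  rw [Finset.mem_smul_finset] at hv
  obtain ⟨y, hy, rfl⟩ := hv
  have hsub : a₃ - a₄ ≠ 0 := sub_ne_zero.mpr h34
  have hval : (a₃ - a₄) • (x + ((a₁ - a₂) / (a₃ - a₄) + 1) • y) =
      a₃ * x - a₄ * x + a₁ * y - a₂ * y + a₃ * y - a₄ * y := by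
    simp only [smul_eq_mul]
    field_simp
    ring
  rw [hval]
  exact Finset.sub_mem_sub (Finset.add_mem_add (Finset.sub_mem_sub (Finset.add_mem_add
    (Finset.sub_mem_sub (Finset.smul_mem_smul_finset (a := a₃) hx)
    (Finset.smul_mem_smul_finset (a := a₄) hx)) (Finset.smul_mem_smul_finset (a := a₁) hy))
    (Finset.smul_mem_smul_finset (a := a₂) hy)) (Finset.smul_mem_smul_finset (a := a₃) hy))
    (Finset.smul_mem_smul_finset (a := a₄) hy)

/-- **Energy step.** If `ξ ≠ 0` has at most `|A|²` representations `a − b = ξ (c − d)` with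
`a, b, c, d ∈ A`, `c ≠ d`, then `E₊(A, ξA) ≤ 2|A|²` and hence `|A|² ≤ 2|A + ξA|`.
[cite: Garaev2007, §2 (the case R(A) = 𝔽_p); GlibichukKonyagin2007, §2] -/
theorem card_sq_le_two_mul_card_add_smul (A : Finset F) {ξ : F} (hξ : ξ ≠ 0)
    (hrep : (((A ×ˢ A) ×ˢ (A ×ˢ A)).filter fun q : (F × F) × (F × F) =>
      q.2.1 ≠ q.2.2 ∧ q.1.1 - q.1.2 = ξ * (q.2.1 - q.2.2)).card ≤ A.card ^ 2) :
    A.card ^ 2 ≤ 2 * (A + ξ • A).card := by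
  classical
  set Rep := ((A ×ˢ A) ×ˢ (A ×ˢ A)).filter fun q : (F × F) × (F × F) =>
      q.2.1 ≠ q.2.2 ∧ q.1.1 - q.1.2 = ξ * (q.2.1 - q.2.2) with hRep
  have hξA : (ξ • A).card = A.card := Finset.card_smul_finset₀ hξ A
  -- the energy, split along `b₁ = b₂`
  set E := ((A ×ˢ A) ×ˢ ((ξ • A) ×ˢ (ξ • A))).filter fun x : (F × F) × (F × F) =>
    x.1.1 + x.2.1 = x.1.2 + x.2.2 with hE
  have hEdef : Finset.addEnergy A (ξ • A) = E.card := rfl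
  set E₁ := E.filter fun x => x.2.1 = x.2.2 with hE₁
  set E₂ := E.filter fun x => ¬ x.2.1 = x.2.2 with hE₂
  have hsplit : E.card = E₁.card + E₂.card := (Finset.card_filter_add_card_filter_not _).symm
  have hE₁ : E₁.card ≤ A.card ^ 2 := by
    rw [sq]
    nth_rw 2 [← hξA]
    rw [← Finset.card_product]
    refine Finset.card_le_card_of_injOn (fun x => (x.1.1, x.2.1)) ?_ ?_
    · intro x hx
      rw [Finset.mem_coe, hE₁, Finset.mem_filter, hE, Finset.mem_filter, Finset.mem_product,
        Finset.mem_product, Finset.mem_product] at hx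
      rw [Finset.mem_coe, Finset.mem_product]
      exact ⟨hx.1.1.1.1, hx.1.1.2.1⟩
    · intro x hx x' hx' h
      rw [Finset.mem_coe, hE₁, Finset.mem_filter, hE, Finset.mem_filter] at hx hx'
      simp only [Prod.mk.injEq] at h
      obtain ⟨h1, h2⟩ := h
      have e2 : x.2 = x'.2 := Prod.ext h2 (by rw [← hx.2, h2, hx'.2])
      have e1 : x.1.2 = x'.1.2 := by
        have q := hx.1.2
        have q' := hx'.1.2
        rw [hx.2] at q
        rw [hx'.2] at q'
        have : x.1.2 = x.1.1 := by linear_combination -q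
        have this' : x'.1.2 = x'.1.1 := by linear_combination -q'
        rw [this, this', h1]
      exact Prod.ext (Prod.ext h1 e1) e2
  have hE₂ : E₂.card ≤ A.card ^ 2 := by
    refine le_trans ?_ hrep
    refine Finset.card_le_card_of_injOn (fun x => ((x.1.1, x.1.2), (ξ⁻¹ * x.2.2, ξ⁻¹ * x.2.1))) ?_ ?_
    · intro x hx
      rw [Finset.mem_coe, hE₂, Finset.mem_filter, hE, Finset.mem_filter, Finset.mem_product,
        Finset.mem_product, Finset.mem_product] at hx
      obtain ⟨⟨⟨⟨ha, hb⟩, hc, hd⟩, heq⟩, hne⟩ := hx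
      rw [Finset.mem_smul_finset] at hc hd
      obtain ⟨c, hcA, hc⟩ := hc
      obtain ⟨d, hdA, hd⟩ := hd
      rw [smul_eq_mul] at hc hd
      rw [Finset.mem_coe, hRep, Finset.mem_filter, Finset.mem_product, Finset.mem_product,
        Finset.mem_product]
      simp only
      rw [← hc, ← hd, ← mul_assoc, ← mul_assoc, inv_mul_cancel₀ hξ, one_mul, one_mul]
      refine ⟨⟨⟨ha, hb⟩, hdA, hcA⟩, ?_, ?_⟩
      · intro hdc; apply hne; rw [← hc, ← hd, hdc]
      · rw [← hc, ← hd] at heq; linear_combination heq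
    · intro x hx x' hx' h
      simp only [Prod.mk.injEq] at h
      obtain ⟨⟨h1, h2⟩, h3, h4⟩ := h
      have h3' : x.2.2 = x'.2.2 := by
        have := congrArg (ξ * ·) h3; simp only [← mul_assoc, mul_inv_cancel₀ hξ, one_mul] at this
        exact this
      have h4' : x.2.1 = x'.2.1 := by
        have := congrArg (ξ * ·) h4; simp only [← mul_assoc, mul_inv_cancel₀ hξ, one_mul] at this
        exact this
      exact Prod.ext (Prod.ext h1 h2) (Prod.ext h4' h3')
  have hEle : Finset.addEnergy A (ξ • A) ≤ 2 * A.card ^ 2 := by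
    rw [hEdef, hsplit]; omega
  have hCS := Finset.le_card_add_mul_addEnergy A (ξ • A)
  rw [hξA] at hCS
  -- |A|^4 ≤ |A + ξA| · 2|A|²
  by_cases hA : A.card = 0
  · rw [hA]; simp
  · have hpos : 0 < A.card ^ 2 := by positivity
    have h4 : A.card ^ 2 * A.card ^ 2 ≤ (2 * (A + ξ • A).card) * A.card ^ 2 := by
      calc A.card ^ 2 * A.card ^ 2 ≤ (A + ξ • A).card * Finset.addEnergy A (ξ • A) := hCS
        _ ≤ (A + ξ • A).card * (2 * A.card ^ 2) := Nat.mul_le_mul_left _ hEle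
        _ = (2 * (A + ξ • A).card) * A.card ^ 2 := by ring
    exact Nat.le_of_mul_le_mul_right h4 hpos

/-- **Translation step.** If `2 ≤ |A|` and the quotient set
`R(A) = {(a − b)/(c − d) : a, b, c, d ∈ A, c ≠ d}` is not all of `ZMod p`, then some `ξ ∈ R(A)`
has `ξ + 1 ∉ R(A)`: otherwise `R(A) ∋ 0` is closed under `+1` and exhausts `ZMod p`.
[cite: GlibichukKonyagin2007, §2 (the quotient-set lemma)] -/
theorem exists_mem_quot_add_one_not_mem {p : ℕ} [Fact p.Prime] (A : Finset (ZMod p))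
    (h2 : 2 ≤ A.card)
    (hR : ((((A ×ˢ A) ×ˢ (A ×ˢ A)).filter fun q : (ZMod p × ZMod p) × (ZMod p × ZMod p) =>
      q.2.1 ≠ q.2.2).image fun q => (q.1.1 - q.1.2) / (q.2.1 - q.2.2)) ≠ Finset.univ) :
    ∃ ξ ∈ ((((A ×ˢ A) ×ˢ (A ×ˢ A)).filter fun q : (ZMod p × ZMod p) × (ZMod p × ZMod p) =>
        q.2.1 ≠ q.2.2).image fun q => (q.1.1 - q.1.2) / (q.2.1 - q.2.2)),
      ξ + 1 ∉ ((((A ×ˢ A) ×ˢ (A ×ˢ A)).filter fun q : (ZMod p × ZMod p) × (ZMod p × ZMod p) =>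
        q.2.1 ≠ q.2.2).image fun q => (q.1.1 - q.1.2) / (q.2.1 - q.2.2)) := by
  classical
  set R := ((((A ×ˢ A) ×ˢ (A ×ˢ A)).filter fun q : (ZMod p × ZMod p) × (ZMod p × ZMod p) =>
      q.2.1 ≠ q.2.2).image fun q => (q.1.1 - q.1.2) / (q.2.1 - q.2.2)) with hRdef
  -- 0 ∈ R
  obtain ⟨c, hc, d, hd, hcd⟩ := Finset.one_lt_card.mp h2
  have h0 : (0 : ZMod p) ∈ R := by
    rw [hRdef, Finset.mem_image]
    refine ⟨((c, c), (c, d)), ?_, ?_⟩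
    · rw [Finset.mem_filter, Finset.mem_product, Finset.mem_product, Finset.mem_product]
      exact ⟨⟨⟨hc, hc⟩, hc, hd⟩, hcd⟩
    · simp
  by_contra hcon
  push Not at hcon
  have hnat : ∀ k : ℕ, ((k : ℕ) : ZMod p) ∈ R := by
    intro k
    induction k with
    | zero => simpa using h0
    | succ k ih =>
        have := hcon _ ih
        push_cast
        exact this
  apply hR
  rw [Finset.eq_univ_iff_forall]
  intro z
  have hz : ((z.val : ℕ) : ZMod p) = z := ZMod.natCast_zmod_val z
  rw [← hz]
  exact hnat z.val

/-- **The Glibichuk–Konyagin dichotomy in sumset form** (Garaev's formulation). For `A ⊆ ZMod p`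
with `2 ≤ |A|` and `|A|² < p` there are `a₁, …, a₆ ∈ A` with
`|A|² ≤ 2 |a₁A − a₂A + a₃A − a₄A + a₅A − a₆A|`. If `R(A) ≠ ZMod p`, take `ξ ∈ R(A)` with
`ξ + 1 ∉ R(A)`: `|A + (ξ+1)A| = |A|²` and `(a₃−a₄)(A + (ξ+1)A)` lies in the six-fold sum; if
`R(A) = ZMod p`, some `ξ ≠ 0` has `≤ |A|⁴/(p−1) ≤ |A|²` representations, so `|A + ξA| ≥ |A|²/2`
and `(a₃−a₄)(A + ξA)` lies in a four-fold sum. [cite: Garaev2007, §§2–3 (proof of Theorem 1)] -/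
theorem glibichuk_konyagin_six_dilates {p : ℕ} [Fact p.Prime] (A : Finset (ZMod p))
    (h2 : 2 ≤ A.card) (hp : A.card ^ 2 < p) :
    ∃ a₁ ∈ A, ∃ a₂ ∈ A, ∃ a₃ ∈ A, ∃ a₄ ∈ A, ∃ a₅ ∈ A, ∃ a₆ ∈ A,
      A.card ^ 2 ≤ 2 * (a₁ • A - a₂ • A + a₃ • A - a₄ • A + a₅ • A - a₆ • A).card := by
  classical
  have hAne : A.Nonempty := Finset.card_pos.mp (by omega)
  set Q' := ((A ×ˢ A) ×ˢ (A ×ˢ A)).filter fun q : (ZMod p × ZMod p) × (ZMod p × ZMod p) =>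
      q.2.1 ≠ q.2.2 with hQ'
  set g : (ZMod p × ZMod p) × (ZMod p × ZMod p) → ZMod p := fun q =>
    (q.1.1 - q.1.2) / (q.2.1 - q.2.2) with hg
  set R := Q'.image g with hRdef
  have hsmulne : ∀ a ∈ A, (a • A).Nonempty := fun a _ => hAne.smul_finset
  by_cases hR : R = Finset.univ
  · -- Case R = ZMod p: a ξ ≠ 0 with few representations
    have hfib : ∀ ξ : ZMod p, (Q'.filter fun q => g q = ξ) =
        ((A ×ˢ A) ×ˢ (A ×ˢ A)).filter fun q : (ZMod p × ZMod p) × (ZMod p × ZMod p) =>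
          q.2.1 ≠ q.2.2 ∧ q.1.1 - q.1.2 = ξ * (q.2.1 - q.2.2) := by
      intro ξ
      rw [hQ', Finset.filter_filter]
      refine Finset.filter_congr fun q _ => ?_
      refine ⟨fun ⟨hne, hq⟩ => ⟨hne, ?_⟩, fun ⟨hne, hq⟩ => ⟨hne, ?_⟩⟩
      · rw [hg] at hq
        have hsub : q.2.1 - q.2.2 ≠ 0 := sub_ne_zero.mpr hne
        rw [← hq]; field_simp
      · rw [hg]
        have hsub : q.2.1 - q.2.2 ≠ 0 := sub_ne_zero.mpr hne
        simp only
        rw [hq]; field_simp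
    have hsum : ∑ ξ ∈ (Finset.univ : Finset (ZMod p)).erase 0, (Q'.filter fun q => g q = ξ).card ≤
        A.card ^ 4 := by
      calc ∑ ξ ∈ (Finset.univ : Finset (ZMod p)).erase 0, (Q'.filter fun q => g q = ξ).card
          ≤ ∑ ξ ∈ (Finset.univ : Finset (ZMod p)), (Q'.filter fun q => g q = ξ).card :=
            Finset.sum_le_sum_of_subset_of_nonneg (Finset.erase_subset _ _) (fun _ _ _ => Nat.zero_le _)
        _ = Q'.card := (Finset.card_eq_sum_card_fiberwise (fun q _ => Finset.mem_univ (g q))).symm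
        _ ≤ ((A ×ˢ A) ×ˢ (A ×ˢ A)).card := Finset.card_filter_le _ _
        _ = A.card ^ 4 := by simp only [Finset.card_product]; ring
    have hp2 : 2 ≤ p := (Fact.out : p.Prime).two_le
    have hUne : ((Finset.univ : Finset (ZMod p)).erase 0).Nonempty := by
      refine ⟨1, ?_⟩
      rw [Finset.mem_erase]
      haveI : Fact (1 < p) := ⟨by omega⟩
      exact ⟨one_ne_zero, Finset.mem_univ _⟩
    have hUcard : ((Finset.univ : Finset (ZMod p)).erase 0).card = p - 1 := by
      rw [Finset.card_erase_of_mem (Finset.mem_univ _), Finset.card_univ, ZMod.card]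
    -- pigeonhole: some ξ ≠ 0 with (p-1)·#fiber ≤ |A|^4
    have hph : ∃ ξ ∈ (Finset.univ : Finset (ZMod p)).erase 0,
        (p - 1) * (Q'.filter fun q => g q = ξ).card ≤ A.card ^ 4 := by
      by_contra hcon
      push Not at hcon
      have : ((Finset.univ : Finset (ZMod p)).erase 0).card * A.card ^ 4 <
          ∑ ξ ∈ (Finset.univ : Finset (ZMod p)).erase 0, (p - 1) * (Q'.filter fun q => g q = ξ).card := by
        rw [← smul_eq_mul, ← Finset.sum_const]
        exact Finset.sum_lt_sum_of_nonempty hUne fun ξ hξ => hcon ξ hξ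
      rw [hUcard, ← Finset.mul_sum] at this
      have h' := Nat.mul_le_mul_left (p - 1) hsum
      omega
    obtain ⟨ξ, hξU, hξ⟩ := hph
    rw [Finset.mem_erase] at hξU
    have hξ0 : ξ ≠ 0 := hξU.1
    have hrep : (Q'.filter fun q => g q = ξ).card ≤ A.card ^ 2 := by
      have hp1 : A.card ^ 2 ≤ p - 1 := by omega
      by_contra hcon
      push Not at hcon
      have hA0 : 0 < A.card ^ 2 := by positivity
      have : A.card ^ 2 * A.card ^ 2 < (p - 1) * (Q'.filter fun q => g q = ξ).card :=
        Nat.mul_lt_mul_of_le_of_lt hp1 hcon (by omega)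
      have e : A.card ^ 2 * A.card ^ 2 = A.card ^ 4 := by ring
      omega
    rw [hfib ξ] at hrep
    have hmain := card_sq_le_two_mul_card_add_smul A hξ0 hrep
    -- ξ ∈ R = univ: write ξ = (a₁ - a₂)/(a₃ - a₄)
    have hξR : ξ ∈ R := by rw [hR]; exact Finset.mem_univ _
    rw [hRdef, Finset.mem_image] at hξR
    obtain ⟨q, hq, hqξ⟩ := hξR
    rw [hQ', Finset.mem_filter, Finset.mem_product, Finset.mem_product, Finset.mem_product] at hq
    obtain ⟨⟨⟨h1, h2'⟩, h3, h4⟩, hne⟩ := hq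
    refine ⟨q.2.1, h3, q.2.2, h4, q.1.1, h1, q.1.2, h2', q.2.1, h3, q.2.2, h4, ?_⟩
    have hsub : q.2.1 - q.2.2 ≠ 0 := sub_ne_zero.mpr hne
    calc A.card ^ 2 ≤ 2 * (A + ξ • A).card := hmain
      _ = 2 * ((q.2.1 - q.2.2) • (A + ξ • A)).card := by rw [Finset.card_smul_finset₀ hsub]
      _ ≤ 2 * (q.2.1 • A - q.2.2 • A + q.1.1 • A - q.1.2 • A).card := by
          refine Nat.mul_le_mul_left 2 (Finset.card_le_card ?_)
          rw [← hqξ, hg]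
          exact smul_add_smul_subset_four A hne
      _ ≤ 2 * (q.2.1 • A - q.2.2 • A + q.1.1 • A - q.1.2 • A + q.2.1 • A).card :=
          Nat.mul_le_mul_left 2 (Finset.card_le_card_add_right (hsmulne _ h3))
      _ ≤ 2 * (q.2.1 • A - q.2.2 • A + q.1.1 • A - q.1.2 • A + q.2.1 • A - q.2.2 • A).card :=
          Nat.mul_le_mul_left 2 (Finset.card_le_card_sub_right (hsmulne _ h4))
  · -- Case R ≠ ZMod p: ξ ∈ R with ξ + 1 ∉ R
    obtain ⟨ξ, hξR, hξ1⟩ := exists_mem_quot_add_one_not_mem A h2 hR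
    have hξR' := hξR
    rw [Finset.mem_image] at hξR'
    obtain ⟨q, hq, hqξ⟩ := hξR'
    rw [Finset.mem_filter, Finset.mem_product, Finset.mem_product, Finset.mem_product] at hq
    obtain ⟨⟨⟨h1, h2'⟩, h3, h4⟩, hne⟩ := hq
    have hinj : ∀ a ∈ A, ∀ b ∈ A, ∀ c ∈ A, ∀ d ∈ A, c ≠ d → ξ + 1 ≠ (a - b) / (c - d) := by
      intro a ha b hb c hc d hd hcd heq
      apply hξ1
      rw [Finset.mem_image]
      refine ⟨((a, b), (c, d)), ?_, ?_⟩
      · rw [Finset.mem_filter, Finset.mem_product, Finset.mem_product, Finset.mem_product]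
        exact ⟨⟨⟨ha, hb⟩, hc, hd⟩, hcd⟩
      · rw [heq]
    have hmain := card_sq_le_card_add_smul_of_forall_ne A (ξ + 1) hinj
    refine ⟨q.2.1, h3, q.2.2, h4, q.1.1, h1, q.1.2, h2', q.2.1, h3, q.2.2, h4, ?_⟩
    have hsub : q.2.1 - q.2.2 ≠ 0 := sub_ne_zero.mpr hne
    calc A.card ^ 2 ≤ (A + (ξ + 1) • A).card := hmain
      _ = ((q.2.1 - q.2.2) • (A + (ξ + 1) • A)).card := by rw [Finset.card_smul_finset₀ hsub]
      _ ≤ (q.2.1 • A - q.2.2 • A + q.1.1 • A - q.1.2 • A + q.2.1 • A - q.2.2 • A).card := by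
          refine Finset.card_le_card ?_
          rw [← hqξ]
          exact smul_add_smul_subset_six A hne
      _ ≤ 2 * (q.2.1 • A - q.2.2 • A + q.1.1 • A - q.1.2 • A + q.2.1 • A - q.2.2 • A).card :=
          Nat.le_mul_of_pos_left _ (by norm_num)

end GK

end Literature.Combinatorics.Additive
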